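import Literature.AlgebraicGeometry.Frobenioids.Thm42PrimaryStepsGeneralWeak
import Literature.AlgebraicGeometry.Frobenioids.Thm42DivIdentityWeak
import HarnessLib

/-!
# [FrdI] Theorem 4.2 (i) AS TYPED, for Frobenioids NOT of perfect type with WEAKLY perf-factorial divisor monoids,
# MODULO ONLY "`Ψ`, `Ψ⁻¹` preserve pre-steps" (Thm. 3.4 (ii)); corollaries over the revised (2024) FSMFF bases

Mochizuki, *The geometry of Frobenioids I: the general theory*, Kyushu J. Math. **62** (2008) 293–400, §4,
Theorem 4.2 p. 77, proof pp. 78–81 (kurims) [cite: MochizukiFrdI2008, Thm. 4.2 (i) p.77]; "passing to the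
perfections" p. 78 ll. 40–46 [cite: MochizukiFrdI2008, Thm. 4.2 (i) p.78]; *Comments* (2024) (28) p. 3 — the
revised definition of "FSMFF type" [cite: MochizukiFrdIComments2024, (28) p.3].

PROOF-ONLY file (cell abc-iut, layer L1, node `FrdI:Thm4.2`; seat abc-iut-L1-t12, row «Thm. 4.2 chain over
`IsPerfFactorialWeak`», L1-lead R129; request of abc-iut-L2-d2).  The weak-hypothesis twin of
`Thm42OfPreStepsGeneral.lean` (seat abc-iut-w4-d105): the typed `PreFrobenioidData.Thm42i` — `Ψ` preserves the steps
that are primary pre-steps, Div-identity endomorphisms, Div-Frobenius-trivial objects and universally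
Div-Frobenius-trivial objects — for Frobenioids `C_i → F_{Φ_i}` with `Φ_i` WEAKLY perf-factorial (Def. 2.4 (i)
(a)(b)(c) + (d_ord) + (d_res), `IsPerfFactorialWeak`; printed case via `IsPerfFactorial.weak`), NOT assumed of
perfect type, under the typed `Thm42Setting` and MODULO ONLY "`Ψ`, `Ψ⁻¹` preserve pre-steps".  Proof = print's:
Thm. 3.4 (iii) at the `C`-level from pre-step preservation (`FrdI.OfPreSteps.*`, seat abc-iut-L1-t11), and
"passing to the perfections" for primary pre-steps (`Thm42PrimaryStepsGeneralWeak.lean`) and Div-identity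
endomorphisms (`FrdI.T42.isDivIdentity_map_weak` at `Ψ^pf : C₁^pf ⥲ C₂^pf`, `Φ_i^pf` weakly perf-factorial by
`IsPerfFactorialWeak.perfection`, seat abc-iut-L2-d2; descent `perfectWLOG_of_equivalence`).
* `FrdI.T42.thm42i_ofFunctor_of_preservesPreSteps_weak` — the typed Thm. 4.2 (i), all four clauses;
* `FrdI.T42.isDivIdentity_map_of_preservesPreSteps_weak` — the Div-identity clause alone;
* `FrdI.T42.thm42i_ofFunctor_of_isOfFSMFFType2024_weak` — over bases of FSMFF-type in the author's revised (2024)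
  sense (`FrdI.isPreStep_map_of_quasiIsotropic_of_isOfFSMFFType2024`, seat abc-iut-L1-t11);
The printed case (Def. 2.4 (i) (a)–(d)) is `thm42i_ofFunctor_of_preservesPreSteps` itself (equivalently: the weak
theorem at `fun X => (hpf_i X).weak`; not restated here).
No new definitions; no landed declaration touched; a named hypothesis is WEAKENED, nothing of the paper restated or
strengthened.  HONEST FRAMING: classical [FrdI] §4 algebra; nothing here bears on [IUTchIII] Cor. 3.12.
-/

namespace Literature.AlgebraicGeometry.Frobenioids

namespace FrdI.T42

open CategoryTheory Opposite PreFrobenioidData PreFrobenioid.Perfection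

universe w v v' u u'

variable {D₁ : Type u} [Category.{v} D₁] {Φ₁ : D₁ᵒᵖ ⥤ CommMonCat.{w}} {C₁ : Type u'} [Category.{v'} C₁]
  {D₂ : Type u} [Category.{v} D₂] {Φ₂ : D₂ᵒᵖ ⥤ CommMonCat.{w}} {C₂ : Type u'} [Category.{v'} C₂]
  {F₁ : C₁ ⥤ ElemFrobenioid Φ₁} {F₂ : C₂ ⥤ ElemFrobenioid Φ₂} (Ψ : C₁ ≌ C₂)

set_option backward.isDefEq.respectTransparency false in
/-- **[FrdI] Thm. 4.2 (i), "`Ψ` preserves Div-identity endomorphisms", for Frobenioids with `Φ_i` WEAKLY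
perf-factorial, NOT assumed of perfect type, under the typed `Thm42Setting` and MODULO ONLY "`Ψ`, `Ψ⁻¹` preserve
pre-steps"** (p. 81 ll. 5–31 with "passing to the perfections", p. 78 ll. 40–46): `Ψ^pf` and `(Ψ^pf)⁻¹` preserve
pre-steps (printed FSMFF bases of standard type (d), `FrdI.isPreStep_map_of_isOfPerfectType`), hence steps, arrows of
Frobenius type and pull-backs (`FrdI.OfPreSteps.*`) and primary pre-steps (`isPrimaryPreStep_map_of_preSteps_weak`);
`isDivIdentity_map_weak` at the perfections (group-like objects: every endomorphism is Div-identity); descent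
`perfectWLOG_of_equivalence`. [cite: MochizukiFrdI2008, Thm. 4.2 (i) p.81] -/
theorem isDivIdentity_map_of_preservesPreSteps_weak (hF₁ : PreFrobenioid.IsFrobenioid F₁)
    (hF₂ : PreFrobenioid.IsFrobenioid F₂)
    (hpf₁ : Objectwise (fun M _ => IsPerfFactorialWeak M) Φ₁)
    (hpf₂ : Objectwise (fun M _ => IsPerfFactorialWeak M) Φ₂)
    (hpre : ∀ ⦃X Y : C₁⦄ (φ : X ⟶ Y), PreFrobenioid.IsPreStep F₁ φ → PreFrobenioid.IsPreStep F₂ (Ψ.functor.map φ))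
    (hpre' : ∀ ⦃X Y : C₂⦄ (φ : X ⟶ Y), PreFrobenioid.IsPreStep F₂ φ → PreFrobenioid.IsPreStep F₁ (Ψ.inverse.map φ))
    (hT : Thm42Setting (ofFunctor Φ₁ F₁) (ofFunctor Φ₂ F₂)) ⦃A : C₁⦄ (α : A ⟶ A)
    (hα : PreFrobenioid.IsDivIdentity F₁ α) : PreFrobenioid.IsDivIdentity F₂ (Ψ.functor.map α) := by
  obtain ⟨hi₁, hi₂, -, -, ⟨N₁, hN₁⟩, ⟨N₂, hN₂⟩⟩ := of_thm42Setting hT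
  have hs₁ := hT.standard.1
  have hs₂ := hT.standard.2
  have hq₁ := hs₁.quasiIsotropic
  have hq₂ := hs₂.quasiIsotropic
  have hΨ : PreFrobenioid.IsFrobeniusCompatible F₁ F₂ Ψ.functor :=
    isFrobeniusCompatible_of_preservesPreSteps hF₁ hF₂ hq₁ hq₂ hs₁.nonDilating hs₂.nonDilating Ψ
      (fun _ _ φ h => hpre φ h) (fun _ _ φ h => hpre' φ h) ⟨N₁, hN₁⟩ ⟨N₂, hN₂⟩
  haveI := map_isEquivalence (hF₁ := hF₁) (hF₂ := hF₂) Ψ hΨ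
  have hiso₁ := isFrobeniusIsotropic_of_isOfIsotropicType hF₁ hi₁
  have hiso₂ := isFrobeniusIsotropic_of_isOfIsotropicType hF₂ hi₂
  -- Prop. 3.2 (iii): the perfections are Frobenioids of perfect and isotropic type
  have hPf₁ := PreFrobenioid.Perfection.isFrobenioid hF₁ hiso₁
  have hPf₂ := PreFrobenioid.Perfection.isFrobenioid hF₂ hiso₂
  have hperfP₁ : PreFrobenioid.IsOfPerfectType (ops hF₁).toFunctor :=
    (ofFunctor_isOfPerfectType (ops hF₁).toFunctor).1 (isOfPerfectType_perfection hF₁ hiso₁)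
  have hperfP₂ : PreFrobenioid.IsOfPerfectType (ops hF₂).toFunctor :=
    (ofFunctor_isOfPerfectType (ops hF₂).toFunctor).1 (isOfPerfectType_perfection hF₂ hiso₂)
  have histrP₁ : PreFrobenioid.IsOfIsotropicType (ops hF₁).toFunctor := isOfIsotropicType_toFunctor hF₁ hiso₁
  have histrP₂ : PreFrobenioid.IsOfIsotropicType (ops hF₂).toFunctor := isOfIsotropicType_toFunctor hF₂ hiso₂
  -- Prop. 5.5 (iii): of standard type
  have hng₁ : ¬ PreFrobenioid.IsOfType (PreFrobenioid.IsGroupLikeObj F₁) := fun h => hN₁ (h N₁)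
  have hng₂ : ¬ PreFrobenioid.IsOfType (PreFrobenioid.IsGroupLikeObj F₂) := fun h => hN₂ (h N₂)
  have hnorm₁ : PreFrobenioid.IsOfType (PreFrobenioid.IsFrobeniusNormalized F₁) :=
    fun X => hs₁.frobeniusNormalized.obj X
  have hnorm₂ : PreFrobenioid.IsOfType (PreFrobenioid.IsFrobeniusNormalized F₂) :=
    fun X => hs₂.frobeniusNormalized.obj X
  have hsP₁ := FrdI.Prop55Sub.prop55iii_pf_standard_of_not_groupLike hF₁ hPf₁ hng₁ hiso₁ hnorm₁ hs₁
  have hsP₂ := FrdI.Prop55Sub.prop55iii_pf_standard_of_not_groupLike hF₂ hPf₂ hng₂ hiso₂ hnorm₂ hs₂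
  have hqP₁ := hsP₁.quasiIsotropic
  have hqP₂ := hsP₂.quasiIsotropic
  have hndP₁ : IsNonDilatingOn (ops hF₁).monFunctor :=
    isNonDilatingOn_of_ofFunctor (F := (ops hF₁).toFunctor) (isNonDilatingOn_ops hF₁ hs₁.nonDilating)
  have hndP₂ : IsNonDilatingOn (ops hF₂).monFunctor :=
    isNonDilatingOn_of_ofFunctor (F := (ops hF₂).toFunctor) (isNonDilatingOn_ops hF₂ hs₂.nonDilating)
  have hNP₁ : ¬ PreFrobenioid.IsGroupLikeObj (ops hF₁).toFunctor ((toPf hF₁).obj N₁) :=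
    fun h => hN₁ ((isGroupLikeObj_ops_iff (hF := hF₁) _).1 h)
  have hNP₂ : ¬ PreFrobenioid.IsGroupLikeObj (ops hF₂).toFunctor ((toPf hF₂).obj N₂) :=
    fun h => hN₂ ((isGroupLikeObj_ops_iff (hF := hF₂) _).1 h)
  -- Def. 2.4 (i), p. 48: `Φ_i^pf` weakly perf-factorial
  have hpfP₁ : Objectwise (fun M _ => IsPerfFactorialWeak M) (ops hF₁).monFunctor :=
    fun X => (hpf₁ X).perfection
  have hpfP₂ : Objectwise (fun M _ => IsPerfFactorialWeak M) (ops hF₂).monFunctor :=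
    fun X => (hpf₂ X).perfection
  -- Thm. 3.4 (ii) for `Ψ^pf` and its quasi-inverse (perfect type, printed FSMFF bases of standard type (d))
  have hpreP : ∀ ⦃X Y : PreFrobenioid.Perfection hF₁⦄ ⦃f : X ⟶ Y⦄,
      PreFrobenioid.IsPreStep (ops hF₁).toFunctor f →
        PreFrobenioid.IsPreStep (ops hF₂).toFunctor
          ((map (hF₁ := hF₁) (hF₂ := hF₂) hΨ).asEquivalence.functor.map f) :=
    fun _ _ _ hf => FrdI.isPreStep_map_of_isOfPerfectType hPf₁ hPf₂ histrP₁ histrP₂ hperfP₁ hsP₂.fsmff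
      (map (hF₁ := hF₁) (hF₂ := hF₂) hΨ).asEquivalence hf
  have hpreP' : ∀ ⦃X Y : PreFrobenioid.Perfection hF₂⦄ ⦃f : X ⟶ Y⦄,
      PreFrobenioid.IsPreStep (ops hF₂).toFunctor f →
        PreFrobenioid.IsPreStep (ops hF₁).toFunctor
          ((map (hF₁ := hF₁) (hF₂ := hF₂) hΨ).asEquivalence.inverse.map f) :=
    fun _ _ _ hf => FrdI.isPreStep_map_of_isOfPerfectType hPf₂ hPf₁ histrP₂ histrP₁ hperfP₂ hsP₁.fsmff
      (map (hF₁ := hF₁) (hF₂ := hF₂) hΨ).asEquivalence.symm hf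
  have hstepP : ∀ ⦃X Y : PreFrobenioid.Perfection hF₁⦄ (f : X ⟶ Y),
      PreFrobenioid.IsStep (ops hF₁).toFunctor f →
        PreFrobenioid.IsStep (ops hF₂).toFunctor
          ((map (hF₁ := hF₁) (hF₂ := hF₂) hΨ).asEquivalence.functor.map f) :=
    fun _ _ _ hf => FrdI.OfPreSteps.isStep_map (map (hF₁ := hF₁) (hF₂ := hF₂) hΨ).asEquivalence hpreP hf
  have hstepP' : ∀ ⦃X Y : PreFrobenioid.Perfection hF₂⦄ (f : X ⟶ Y),
      PreFrobenioid.IsStep (ops hF₂).toFunctor f →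
        PreFrobenioid.IsStep (ops hF₁).toFunctor
          ((map (hF₁ := hF₁) (hF₂ := hF₂) hΨ).asEquivalence.inverse.map f) :=
    fun _ _ _ hf => FrdI.OfPreSteps.isStep_map (map (hF₁ := hF₁) (hF₂ := hF₂) hΨ).asEquivalence.symm hpreP' hf
  -- Thm. 3.4 (iii) for `Ψ^pf`: arrows of Frobenius type and pull-back morphisms
  have hfrobP : ∀ ⦃X Y : PreFrobenioid.Perfection hF₁⦄ (f : X ⟶ Y),
      PreFrobenioid.IsFrobeniusType (ops hF₁).toFunctor f →
        PreFrobenioid.IsFrobeniusType (ops hF₂).toFunctor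
          ((map (hF₁ := hF₁) (hF₂ := hF₂) hΨ).asEquivalence.functor.map f) := fun _ _ _ hf =>
    FrdI.OfPreSteps.isFrobeniusType_map_quasiIsotropic hPf₁ hPf₂ hqP₁ hqP₂ hndP₁ hndP₂
      (map (hF₁ := hF₁) (hF₂ := hF₂) hΨ).asEquivalence hpreP hpreP' hNP₁ hNP₂ hf
  have hpbP : ∀ ⦃X Y : PreFrobenioid.Perfection hF₁⦄ (f : X ⟶ Y),
      PreFrobenioid.IsPullbackMorphism (ops hF₁).toFunctor f →
        PreFrobenioid.IsPullbackMorphism (ops hF₂).toFunctor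
          ((map (hF₁ := hF₁) (hF₂ := hF₂) hΨ).asEquivalence.functor.map f) := fun _ _ _ hf =>
    FrdI.OfPreSteps.isPullbackMorphism_map_quasiIsotropic hPf₁ hPf₂ hqP₁ hqP₂ hndP₁ hndP₂
      (map (hF₁ := hF₁) (hF₂ := hF₂) hΨ).asEquivalence hpreP hpreP' hNP₁ hNP₂ hf
  -- Thm. 4.2 (i), primary pre-steps, for `Ψ^pf` and `(Ψ^pf)⁻¹`
  have hprimP : ∀ ⦃X Y : PreFrobenioid.Perfection hF₁⦄ (f : X ⟶ Y),
      PreFrobenioid.IsPrimaryPreStep (ops hF₁).toFunctor f →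
        PreFrobenioid.IsPrimaryPreStep (ops hF₂).toFunctor
          ((map (hF₁ := hF₁) (hF₂ := hF₂) hΨ).asEquivalence.functor.map f) :=
    fun _ _ _ h => PreFrobenioid.isPrimaryPreStep_map_of_preSteps_weak
      (map (hF₁ := hF₁) (hF₂ := hF₂) hΨ).asEquivalence hPf₁ hPf₂ hperfP₁ hperfP₂ histrP₁ histrP₂ hpfP₁ hpfP₂
      hstepP (fun _ _ f hf => hpreP hf) (fun _ _ f hf => hpreP' hf) h
  have hprimP' : ∀ ⦃X Y : PreFrobenioid.Perfection hF₂⦄ (f : X ⟶ Y),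
      PreFrobenioid.IsPrimaryPreStep (ops hF₂).toFunctor f →
        PreFrobenioid.IsPrimaryPreStep (ops hF₁).toFunctor
          ((map (hF₁ := hF₁) (hF₂ := hF₂) hΨ).asEquivalence.inverse.map f) :=
    fun _ _ _ h => PreFrobenioid.isPrimaryPreStep_inverse_map_of_preSteps_weak
      (map (hF₁ := hF₁) (hF₂ := hF₂) hΨ).asEquivalence hPf₁ hPf₂ hperfP₁ hperfP₂ histrP₁ histrP₂ hpfP₁ hpfP₂
      hstepP' (fun _ _ f hf => hpreP hf) (fun _ _ f hf => hpreP' hf) h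
  -- row T42-L11 for `Ψ^pf` (group-like objects: every endomorphism is a Div-identity endomorphism)
  have hdiv_pf : ∀ ⦃X : PreFrobenioid.Perfection hF₁⦄ (f : X ⟶ X), (ops hF₁).IsDivIdentity f →
      (ops hF₂).IsDivIdentity ((map (hF₁ := hF₁) (hF₂ := hF₂) hΨ).map f) := by
    intro X f hf
    have hf' : PreFrobenioid.IsDivIdentity (ops hF₁).toFunctor f :=
      (ofFunctor_isDivIdentity (ops hF₁).toFunctor f).1 hf
    refine (ofFunctor_isDivIdentity (ops hF₂).toFunctor _).2 ?_
    by_cases hX : PreFrobenioid.IsGroupLikeObj (ops hF₁).toFunctor X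
    · exact PreFrobenioid.isDivIdentity_of_isGroupLikeObj
        (FrdI.OfPreSteps.isGroupLikeObj_map hPf₁ hPf₂ histrP₁ histrP₂
          (map (hF₁ := hF₁) (hF₂ := hF₂) hΨ).asEquivalence hpreP' hX) _
    · exact isDivIdentity_map_weak (map (hF₁ := hF₁) (hF₂ := hF₂) hΨ).asEquivalence hPf₁ hPf₂ hperfP₁ hperfP₂
        histrP₁ histrP₂ hpfP₁ hpfP₂ (fun _ _ f hf => hpreP hf) (fun _ _ f hf => hpreP' hf) hfrobP hpbP hndP₂
        hprimP hprimP' f hf'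
  -- row T42-L03: transport down to the `C_i`
  exact (perfectWLOG_of_equivalence hF₁ hF₂ Ψ hΨ).2 hdiv_pf α hα

set_option backward.isDefEq.respectTransparency false in
/-- **Theorem 4.2 (i) AS TYPED (`PreFrobenioidData.Thm42i`), for Frobenioids `C_i → F_{Φ_i}` with `Φ_i` WEAKLY
perf-factorial, NOT assumed of perfect type, with NO hypothesis on the bases beyond print's standard type (Def. 3.1
(i)(d)), MODULO "`Ψ` and `Ψ⁻¹` preserve pre-steps"** (Thm. 3.4 (ii), first clause): under `Thm42Setting`, `Ψ`
preserves the steps that are primary pre-steps, Div-identity endomorphisms, Div-Frobenius-trivial objects and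
universally Div-Frobenius-trivial objects — the weak-hypothesis twin of `thm42i_ofFunctor_of_preservesPreSteps`
(seat abc-iut-w4-d105): Thm. 3.4 (iii) at the `C`-level from pre-step preservation (`FrdI.OfPreSteps.*`), primary
pre-steps and Div-identity endomorphisms through the perfections (`isPrimaryPreStep_map_of_preservesPreSteps_weak`,
`isDivIdentity_map_of_preservesPreSteps_weak`), (universally) Div-Frobenius-trivial objects by
`PreFrobenioid.isDivFrobeniusTrivial_map` / `isUniversallyDivFrobeniusTrivial_map` (seat abc-iut-L1-t14).
[cite: MochizukiFrdI2008, Thm. 4.2 (i) p.77] -/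
theorem thm42i_ofFunctor_of_preservesPreSteps_weak (hF₁ : PreFrobenioid.IsFrobenioid F₁)
    (hF₂ : PreFrobenioid.IsFrobenioid F₂)
    (hpf₁ : Objectwise (fun M _ => IsPerfFactorialWeak M) Φ₁)
    (hpf₂ : Objectwise (fun M _ => IsPerfFactorialWeak M) Φ₂)
    (hpre : ∀ ⦃X Y : C₁⦄ (φ : X ⟶ Y), PreFrobenioid.IsPreStep F₁ φ → PreFrobenioid.IsPreStep F₂ (Ψ.functor.map φ))
    (hpre' : ∀ ⦃X Y : C₂⦄ (φ : X ⟶ Y), PreFrobenioid.IsPreStep F₂ φ → PreFrobenioid.IsPreStep F₁ (Ψ.inverse.map φ)) :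
    (ofFunctor Φ₁ F₁).Thm42i (ofFunctor Φ₂ F₂) Ψ := by
  intro hT
  obtain ⟨-, -, hnd₁, hnd₂, ⟨N₁, hN₁⟩, ⟨N₂, hN₂⟩⟩ := of_thm42Setting hT
  have hq₁ := hT.standard.1.quasiIsotropic
  have hq₂ := hT.standard.2.quasiIsotropic
  have hP₂ := hF₂.isPreFrobenioid
  have hpreI : ∀ ⦃A B : C₁⦄ ⦃φ : A ⟶ B⦄, PreFrobenioid.IsPreStep F₁ φ →
      PreFrobenioid.IsPreStep F₂ (Ψ.functor.map φ) := fun _ _ φ h => hpre φ h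
  have hpreI' : ∀ ⦃A B : C₂⦄ ⦃φ : A ⟶ B⦄, PreFrobenioid.IsPreStep F₂ φ →
      PreFrobenioid.IsPreStep F₁ (Ψ.inverse.map φ) := fun _ _ φ h => hpre' φ h
  -- Thm. 3.4 (iii) at the level of the `C_i`, from pre-step preservation
  have hfrob : ∀ ⦃X Y : C₁⦄ (φ : X ⟶ Y), PreFrobenioid.IsFrobeniusType F₁ φ →
      PreFrobenioid.IsFrobeniusType F₂ (Ψ.functor.map φ) := fun _ _ _ h =>
    FrdI.OfPreSteps.isFrobeniusType_map_quasiIsotropic hF₁ hF₂ hq₁ hq₂ hnd₁ hnd₂ Ψ hpreI hpreI' hN₁ hN₂ h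
  have hdeg : ∀ ⦃X Y : C₁⦄ (φ : X ⟶ Y),
      PreFrobenioid.degFr F₂ (Ψ.functor.map φ) = PreFrobenioid.degFr F₁ φ := fun _ _ φ =>
    FrdI.OfPreSteps.degFr_map hF₁ hF₂ hq₁ hq₂ hnd₁ hnd₂ Ψ hpreI hpreI' hN₁ hN₂ φ
  have hpb' : ∀ ⦃X Y : C₂⦄ (φ : X ⟶ Y), PreFrobenioid.IsPullbackMorphism F₂ φ →
      PreFrobenioid.IsPullbackMorphism F₁ (Ψ.inverse.map φ) := fun _ _ _ h =>
    FrdI.OfPreSteps.isPullbackMorphism_map_quasiIsotropic hF₂ hF₁ hq₂ hq₁ hnd₂ hnd₁ Ψ.symm hpreI' hpreI hN₂ hN₁ h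
  -- primary pre-steps and Div-identity endomorphisms through the perfections
  have hprim : ∀ ⦃X Y : C₁⦄ (φ : X ⟶ Y), PreFrobenioid.IsPrimaryPreStep F₁ φ →
      PreFrobenioid.IsPrimaryPreStep F₂ (Ψ.functor.map φ) :=
    isPrimaryPreStep_map_of_preservesPreSteps_weak Ψ hF₁ hF₂ hpf₁ hpf₂ hpre hpre' hT
  have hdivid : ∀ ⦃A : C₁⦄ (α : A ⟶ A), PreFrobenioid.IsDivIdentity F₁ α →
      PreFrobenioid.IsDivIdentity F₂ (Ψ.functor.map α) :=
    isDivIdentity_map_of_preservesPreSteps_weak Ψ hF₁ hF₂ hpf₁ hpf₂ hpre hpre' hT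
  refine ⟨fun X Y φ hφ => ⟨⟨hpre φ hφ.1.1, fun h => hφ.1.2
      (by haveI := h; exact Ψ.fullyFaithfulFunctor.isIso_of_isIso_map φ)⟩, hprim φ hφ.2⟩,
    fun A α hα => ?_, fun A hA => ?_, fun A hA => ?_⟩
  · -- Div-identity endomorphisms
    rw [ofFunctor_isDivIdentity F₁] at hα
    rw [ofFunctor_isDivIdentity F₂]
    exact hdivid α hα
  · -- Div-Frobenius-trivial objects
    rw [ofFunctor_isDivFrobeniusTrivial F₁] at hA
    rw [ofFunctor_isDivFrobeniusTrivial F₂]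
    exact PreFrobenioid.isDivFrobeniusTrivial_map Ψ hfrob hdeg (fun α h => hdivid α h) hA
  · -- universally Div-Frobenius-trivial objects
    have hA' : PreFrobenioid.IsUniversallyDivFrobeniusTrivial F₁ A := fun A' φ hφ =>
      (ofFunctor_isDivFrobeniusTrivial F₁ A').1 (hA φ ((ofFunctor_isPullbackMorphism F₁ φ).2 hφ))
    intro A₂ ψ hψ
    rw [ofFunctor_isDivFrobeniusTrivial F₂]
    exact PreFrobenioid.isUniversallyDivFrobeniusTrivial_map Ψ hP₂ hfrob hdeg hpb' (fun _ _ _ α h => hdivid α h)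
      hA' ψ ((ofFunctor_isPullbackMorphism F₂ ψ).1 hψ)

/-- **Theorem 4.2 (i) AS TYPED over FSMFF-type bases in the author's revised (2024) sense**, for Frobenioids with
`Φ_i` WEAKLY perf-factorial, NOT assumed of perfect type (Thm. 3.4 (ii) over such bases:
`FrdI.isPreStep_map_of_quasiIsotropic_of_isOfFSMFFType2024`, seat abc-iut-L1-t11).
[cite: MochizukiFrdI2008, Thm. 4.2 (i) p.77] [cite: MochizukiFrdIComments2024, (28) p.3] -/
theorem thm42i_ofFunctor_of_isOfFSMFFType2024_weak (hF₁ : PreFrobenioid.IsFrobenioid F₁)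
    (hF₂ : PreFrobenioid.IsFrobenioid F₂)
    (hpf₁ : Objectwise (fun M _ => IsPerfFactorialWeak M) Φ₁)
    (hpf₂ : Objectwise (fun M _ => IsPerfFactorialWeak M) Φ₂)
    (hD₁ : IsOfFSMFFType2024 D₁) (hD₂ : IsOfFSMFFType2024 D₂) :
    (ofFunctor Φ₁ F₁).Thm42i (ofFunctor Φ₂ F₂) Ψ := fun hT =>
  thm42i_ofFunctor_of_preservesPreSteps_weak Ψ hF₁ hF₂ hpf₁ hpf₂
    (fun _ _ _ h => FrdI.isPreStep_map_of_quasiIsotropic_of_isOfFSMFFType2024 hF₁ hF₂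
      hT.standard.1.quasiIsotropic hT.standard.2.quasiIsotropic hD₁ hD₂ Ψ h)
    (fun _ _ _ h => FrdI.isPreStep_map_of_quasiIsotropic_of_isOfFSMFFType2024 hF₂ hF₁
      hT.standard.2.quasiIsotropic hT.standard.1.quasiIsotropic hD₂ hD₁ Ψ.symm h) hT

end FrdI.T42

end Literature.AlgebraicGeometry.Frobenioids
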